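import Summits.Langlands.Langlands.Theorems.PicardMuOrdinaryMuOrdinaryFamilyRTThorneCompanionsDebts
import HarnessLib

/-!
# Crux `MuOrdinaryFamilyRT` (stmt-Langlands-13757), line `thorne-minimal-lift`: the WEIGHT DATA of the family,
# folded into the family stub (Defs file no. 4 of the line; skeleton v5, lead prover-line-stmt-Langlands-13757-c3-0)

Skeleton v4 of the line carried a registered stub `stub_weightSpace` — statement **(W)**, the weight-space core of
the Galois side G3 (`Missing.arithmeticPointsNearPicard`) of the companions stub, UNIVERSALLY quantified over all
integral B-ordinary families `𝓕 : OrdFamily f ι e S₀ ρ_C` of dimension `≥ 4`: "there are a finite `E/ℚ₃` and, for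
every `M`, an `E`-integral weight `κ : Λ → ℚ̄₃` within `3^{-M}` of the Picard weight `κ_C = j ∘ x ∘ (Λ → R)`
uniformly on `Λ`, and gap-`≥ 2` labelled weights `λ_w` (`w ∣ 3` in the auxiliary CM quadratic `F'/K`), such that
the inertial characters `κ ∘ wt v i`, transported to `w`, are the algebraic characters of `λ_w` on an open subgroup
of inertia".  Wave 3 (worker W-B, report `stub_arithmeticPoints.md`, item evidence) proved everything of G3 about
POINTS (`…ThorneArithmeticPoints`, p151521: `stub_arithmeticPoints_of : (W) → G3`) and diagnosed (W) itself as NOT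
PROVABLE from the `OrdFamily` axioms as a universal statement: the axioms pin the two END characters of the Picard
weight on an open subgroup of inertia (`OrdFamily.ends`) but say nothing about the MIDDLE character (in truth
`∏_τ τ^{-h_τ}` with `h = (0,1)` up to a finite character — `ρ_C` is de Rham — a Picard `p`-adic Hodge input no typed
hypothesis carries, report § M3), nor that `Spec Λ` is the `m`-polarized weight space with `wt` its universal
characters.  (W) is a property of the INTENDED WITNESS of `stub_minimalFamily` (the minimal ordinary branch through
`x_C`, whose weight algebra is the Iwasawa algebra of the polarized torus and whose arithmetic weights are dense at
every de Rham point), not a theorem about abstract families.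

This file therefore FOLDS (W) into the family existential (skeleton v5):

* `WeightDataOver 𝓕 F'` — the conclusion of (W) for one family and one auxiliary field, verbatim;
* `HasWeightData 𝓕` — the same for every admissible auxiliary field (`F'/K` Galois CM quadratic, Galois over
  `ℚ`, every place above `3` split from `F'⁺`, so `F'_w ≅ K_λ`);
* `T.stub_minimalFamilyW` — `T.stub_minimalFamily` (…ThorneDefs § 3) with the extra conjunct `HasWeightData 𝓕`:
  the ONE conjecture-sized Galois-family debt of the line (M1 `Missing.minimalOrdinaryBranch` + P0 + the Iwasawa
  weight algebra with dense arithmetic weights near `x_C`);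
* `T.stub_companionsW`, `T.stub_definiteHostPlusW` — the companions stub and K1⁺ RELATIVISED to families carrying
  weight data (extra hypothesis `HasWeightData 𝓕`); the reductions `stub_companionsW_of : MF1 → MF2 → G1 →
  T.stub_companionsW` (no G3 hypothesis any more), `definiteHostPlusW_of`, `MuOrdinaryFamilyRT_of_plusW` and
  `MuOrdinaryFamilyRT_of_thorneStubsW` are the companion Reduction file `…ThorneWeightReduction`;
* `stub_minimalFamily_of_W : T.stub_minimalFamilyW → T.stub_minimalFamily` — the registered handle (projection).

Nothing is asserted here (`def … : Prop` and one projection).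
-/

set_option linter.dupNamespace false

namespace Summit.Langlands.Langlands.Cruxes.MuOrdinaryFamilyRT.ThorneMinimalLift

open scoped NumberField Polynomial Matrix Classical
open Field IsDedekindDomain Polynomial
open Literature.NumberTheory.GaloisRepresentations Literature.NumberTheory.Automorphic
open Summit.Langlands.Langlands.Cruxes.MuOrdinaryFamilyRT.CharZeroDominance

noncomputable section

variable {f : ℤ[X]} {ι : PadicAlgCl 3 ≃+* ℂ} {e : K →+* ℂ} {S₀ : Finset (HeightOneSpectrum (𝓞 K))}
  {ρC : FramedGaloisRep K (PadicAlgCl 3) 3}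

/-! ## 1. The weight data of a family -/

/-- **`WeightDataOver 𝓕 F'` — statement (W) for ONE family and ONE auxiliary field, verbatim** (the hypothesis of
the landed `stub_arithmeticPoints_of`, …ThorneArithmeticPoints, specialised to `𝓕`, `F'`): a finite `E/ℚ₃` and,
for every `M`, an `E`-integral weight `κ : Λ → ℚ̄₃` within `3^{-M}` of the Picard weight uniformly on `Λ`, together
with gap-`≥ 2` labelled weights `λ_w` at the places `w ∣ 3` of `F'`, a transport `(v, γ, φ)` of the decomposition
group of each such `w` to a place `v ∣ 3` of `K`, and, for every canonical local Artin datum of `F'_w`, an open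
subgroup of inertia on which `φ` lands in `I_{K_v}` and `κ ∘ wt v i ∘ φ` IS the algebraic character
`∏_τ τ(Art⁻¹ ·)^{-(λ_{τ,3-i}+i-1)}` (`ordinaryWeightUnit`). -/
def WeightDataOver (𝓕 : OrdFamily f ι e S₀ ρC) (F' : Type) [Field F'] [NumberField F'] [Algebra K F'] : Prop :=
  ∃ E : IntermediateField ℚ_[3] (PadicAlgCl 3), FiniteDimensional ℚ_[3] E ∧
    ∀ M : ℕ, ∃ κ : 𝓕.Λ →+* PadicAlgCl 3,
      (∀ a : 𝓕.Λ, κ a ∈ E ∧ ‖κ a‖ ≤ 1) ∧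
      (∀ a : 𝓕.Λ, ‖κ a - 𝓕.j (𝓕.x (algebraMap 𝓕.Λ 𝓕.R a))‖ ≤ ((3 : ℝ)⁻¹) ^ M) ∧
      ∃ wt : (w : HeightOneSpectrum (𝓞 F')) → LabelledWeight (w.adicCompletion F') (PadicAlgCl 3) 3,
        ∀ w : HeightOneSpectrum (𝓞 F'), ((3 : ℕ) : 𝓞 F') ∈ w.asIdeal →
          (∀ τ (i j : Fin 3), i < j → wt w τ j + 2 ≤ wt w τ i) ∧
          ∃ (v : HeightOneSpectrum (𝓞 K)) (γ : absoluteGaloisGroup K)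
            (φ : absoluteGaloisGroup (w.adicCompletion F') → absoluteGaloisGroup (v.adicCompletion K)),
            (3 : 𝓞 K) ∈ v.asIdeal ∧
            (∀ τ : absoluteGaloisGroup (w.adicCompletion F'),
              absGaloisRestrict K F' (absGaloisRestrict F' (w.adicCompletion F') τ) =
                γ * absGaloisRestrict K (v.adicCompletion K) (φ τ) * γ⁻¹) ∧
            ∀ art : LocalArtinData (w.adicCompletion F'), art.IsCanonical →
              ∃ U : OpenSubgroup (absoluteGaloisGroup (w.adicCompletion F')),
                ∀ τw ∈ WeilGroup.inertia (w.adicCompletion F'),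
                  WeilGroup.toAbsGalois (w.adicCompletion F') τw ∈ U →
                    φ (WeilGroup.toAbsGalois (w.adicCompletion F') τw) ∈ absInertia (v.adicCompletion K) ∧
                    ∀ i : Fin 3, κ (𝓕.wt v i (φ (WeilGroup.toAbsGalois (w.adicCompletion F') τw))) =
                      (ordinaryWeightUnit (wt w) i (art.artin τw) : PadicAlgCl 3)

/-- **`HasWeightData 𝓕` — the family carries arithmetic weight data over EVERY admissible auxiliary field**
(`F'/K` a Galois CM quadratic extension, Galois over `ℚ`, with every place above `3` split from `F'⁺`, so that
`F'_w ≅ K_λ`): (W) with its quantifier over families removed.  A property of the intended witness of the family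
stub (the minimal ordinary branch through `x_C` over the Iwasawa algebra of the polarized torus: its weight
characters are the universal ones, its arithmetic weights of any residual nebentype are `3`-adically dense, and the
Picard weight is arithmetic-analytic because `ρ_C` is de Rham at `λ` with labelled Hodge–Tate weights
`{0,0,1}, {0,1,1}`). -/
def HasWeightData (𝓕 : OrdFamily f ι e S₀ ρC) : Prop :=
  ∀ (F' : Type) [Field F'] [NumberField F'] [Algebra K F'] [IsGalois ℚ F'] [NumberField.IsCMField F'],
    Module.finrank K F' = 2 → ThreeSplitFromMaximalReal F' → WeightDataOver 𝓕 F'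

/-! ## 2. The stubs of skeleton v5 that change -/

/-- **`T.stub_minimalFamilyW` — THE GALOIS FAMILY, with its weight data (skeleton v5; replaces
`T.stub_minimalFamily` + `stub_weightSpace` of v4).**  For generic `f` with `ρ_C` in the main class there is an
integral B-ordinary polarized `Λ`-adic family through `ρ_C` of Krull dimension `≥ 4`, minimal away from `3`
(`PotUnramifiedFamily`), with weight algebra `𝒪⟦T₁,T₂,T₃⟧`, AND carrying arithmetic weight data near the Picard
weight (`HasWeightData`).  One conjecture-sized debt: M1 `Missing.minimalOrdinaryBranch` (…ThorneDebts § 1: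
Kisin generic-fibre representability + Greenberg–Wiles count with `E`-coefficients + Geraghty's flag scheme at the
RAMIFIED prime, unprinted as such) + P0 `Missing.picardPolarized` + the presentation of the branch over the Iwasawa
algebra of the `m`-polarized torus (dense arithmetic weights; label-analyticity of the middle character of `x_C`).
[Kisin 2003/2008 § 2.3; Allen arXiv:1411.7661 §§ 1–2; Geraghty Math. Ann. 373 § 3; CHT § 2; Hida 1986] -/
def T.stub_minimalFamilyW : Prop :=
  ∀ (f : ℤ[X]) (ι : PadicAlgCl 3 ≃+* ℂ) (e : K →+* ℂ) (S₀ : Finset (HeightOneSpectrum (𝓞 K)))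
    (ρC : FramedGaloisRep K (PadicAlgCl 3) 3),
    Generic f → PicardInput f ι e S₀ ρC → MainClassPlus f S₀ ρC →
    ∃ 𝓕 : OrdFamily f ι e S₀ ρC, ((4 : ℕ) : WithBot ℕ∞) ≤ ringKrullDim 𝓕.R ∧ PotUnramifiedFamily 𝓕 ∧
      Nonempty (𝓕.Λ ≃+* MvPowerSeries (Fin 3) 𝓕.𝒪) ∧ HasWeightData 𝓕

/-- **`T.stub_companionsW` — the companions stub RELATIVISED to families with weight data** (`T.stub_companions`
of …ThorneDefs § 3 with the extra hypothesis `HasWeightData 𝓕`; derived in …ThorneWeightReduction from MF1, MF2 and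
G1 alone — the Galois side G3 is now `HasWeightData` + the landed point lemmas). -/
def T.stub_companionsW : Prop :=
  ∀ (f : ℤ[X]) (ι : PadicAlgCl 3 ≃+* ℂ) (e : K →+* ℂ) (S₀ : Finset (HeightOneSpectrum (𝓞 K)))
    (ρC : FramedGaloisRep K (PadicAlgCl 3) 3) (𝓕 : OrdFamily f ι e S₀ ρC),
    Generic f → PicardInput f ι e S₀ ρC → MainClassPlus f S₀ ρC →
    ((4 : ℕ) : WithBot ℕ∞) ≤ ringKrullDim 𝓕.R → PotUnramifiedFamily 𝓕 → Module.Finite 𝓕.Λ 𝓕.R →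
    HasWeightData 𝓕 →
    ∃ (F' : Type) (_ : Field F') (_ : NumberField F') (_ : Algebra K F') (_ : IsGalois ℚ F')
      (hcpt' : isCompact_glFiniteIntegralLevel 3 F') (S' : Finset (HeightOneSpectrum (𝓞 F')))
      (D : Set (𝓕.Λ →+* PadicAlgCl 3)) (E : IntermediateField ℚ_[3] (PadicAlgCl 3)),
      Module.finrank K F' = 2 ∧ NumberField.IsCMField F' ∧
      ((rbar f 𝓕.B).comp (absGaloisRestrict K F').toMonoidHom).range = (rbar f 𝓕.B).range ∧
      FiniteDimensional ℚ_[3] E ∧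
      (∀ w : HeightOneSpectrum (𝓞 F'), w.under (𝓞 K) ∈ S₀ → w ∈ S') ∧
      (∀ κ ∈ D, ∀ a : 𝓕.Λ, κ a ∈ E ∧ ‖κ a‖ ≤ 1) ∧
      (∀ M : ℕ, ∃ κ ∈ D, ∀ a : 𝓕.Λ,
        ‖κ a - 𝓕.j (𝓕.x (algebraMap 𝓕.Λ 𝓕.R a))‖ ≤ ((3 : ℝ)⁻¹) ^ M) ∧
      ∀ y : 𝓕.R →+* PadicAlgCl 3, y.comp (algebraMap 𝓕.Λ 𝓕.R) ∈ D →
        HasOrdinaryCompanion 𝓕 F' hcpt' S' y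

/-- **`T.stub_definiteHostPlusW` — K1⁺ RELATIVISED to families with weight data** (`T.stub_definiteHostPlus` of
…ThorneDefs § 3 with the extra hypothesis `HasWeightData 𝓕`; this is what the v5 composition consumes at the
witness of `T.stub_minimalFamilyW`). -/
def T.stub_definiteHostPlusW : Prop :=
  ∀ (f : ℤ[X]) (ι : PadicAlgCl 3 ≃+* ℂ) (e : K →+* ℂ) (S₀ : Finset (HeightOneSpectrum (𝓞 K)))
    (ρC : FramedGaloisRep K (PadicAlgCl 3) 3) (𝓕 : OrdFamily f ι e S₀ ρC),
    Generic f → PicardInput f ι e S₀ ρC → MainClassPlus f S₀ ρC →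
    ((4 : ℕ) : WithBot ℕ∞) ≤ ringKrullDim 𝓕.R → PotUnramifiedFamily 𝓕 →
    Nonempty (𝓕.Λ ≃+* MvPowerSeries (Fin 3) 𝓕.𝒪) → HasWeightData 𝓕 →
    Module.Finite 𝓕.Λ 𝓕.R ∧
    ∃ (F' : Type) (_ : Field F') (_ : NumberField F') (_ : Algebra K F')
      (hcpt' : isCompact_glFiniteIntegralLevel 3 F') (S' : Finset (HeightOneSpectrum (𝓞 F')))
      (D : Set (𝓕.Λ →+* PadicAlgCl 3)) (E : IntermediateField ℚ_[3] (PadicAlgCl 3)),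
      Module.finrank K F' = 2 ∧ FiniteDimensional ℚ_[3] E ∧
      (∀ w : HeightOneSpectrum (𝓞 F'), w.under (𝓞 K) ∈ S₀ → w ∈ S') ∧
      (∀ κ ∈ D, ∀ a : 𝓕.Λ, κ a ∈ E ∧ ‖κ a‖ ≤ 1) ∧
      (∀ M : ℕ, ∃ κ ∈ D, ∀ a : 𝓕.Λ,
        ‖κ a - 𝓕.j (𝓕.x (algebraMap 𝓕.Λ 𝓕.R a))‖ ≤ ((3 : ℝ)⁻¹) ^ M) ∧
      (∀ y : 𝓕.R →+* PadicAlgCl 3, y.comp (algebraMap 𝓕.Λ 𝓕.R) ∈ D → IsClassicalOver 𝓕 F' hcpt' S' y)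

/-! ## 3. Registered handle -/

/-- **The v5 family stub implies the v4 one** (projection; the registered handle through which this Defs file
lands on the crux item). -/
theorem stub_minimalFamily_of_W : T.stub_minimalFamilyW → T.stub_minimalFamily := by
  intro h f ι e S₀ ρC hgen hin hM
  obtain ⟨𝓕, hdim, hpur, hΛ, -⟩ := h f ι e S₀ ρC hgen hin hM
  exact ⟨𝓕, hdim, hpur, hΛ⟩

end

end Summit.Langlands.Langlands.Cruxes.MuOrdinaryFamilyRT.ThorneMinimalLift
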